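import Literature.NumberTheory.Automorphic.ArchU21SplitOrbitSmoothParam       -- ★ (e3-4b) `exists_contDiff_normaliser_smul_integral_descConj_boostEig_eq_param`; brings ★ (e3-4a) `normaliser_smul_integral_descConj_boostEig_eq_smul_integral_prod`, ★ (e3-3), ★ `boostEig`
import Literature.NumberTheory.Automorphic.ArchU21SplitPlaceTransport         -- ★ (A2) `cosetCongr`, `integral_descConj_map_cosetCongr_subgroup`, `exists_splitPlace_transport_smul_map` (the binder producer)
import Literature.NumberTheory.Automorphic.ArchInnerFormChartOrbLocal         -- ★ G2 `chartOrbGLoc`, `chartOrbGLoc_eq_of_isHaarMeasure`, `chartHaarGLoc`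
import HarnessLib

/-!
# The parabolic reading of the split-chart orbital functional on `U(2,1)_w`, ONE PLACE, in the house chart currency:
# `Δ_w(c) · chartOrbGLoc(f)(c) = C_w · ∫_{K×N} f(φ_w⁻¹(k · m a_{x∕2} n a_{x∕2} · k⁻¹))`, its smooth extension through the wall with the corner value, and the `Ad(K)`-invariant reduction
# (N8-INNER brick (10)(KN); Harish-Chandra's `'F_f` on the maximally split Cartan: Varadarajan 1977 I §1.12; Rogawski 1990 §4.9, §8.2; Knapp 1986 XI §7)

Topic `NumberTheory/Rogawski1990`; namespace `Literature.NumberTheory.Automorphic.UnitaryGroup` (the currency's).  THEOREMS ONLY (no `def`, no instance, no notation, no axiom,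
no named fact, no `sorry`).  Cell `pub/hodgecm-mathlib`, crux H413 (`stmt-HodgeConjecture-24833`), half-A line LH2, road «N8-INNER» (LEAD T14-4 (L2)), brick (10)(KN)
«PARABOLIC READING ON `U(2,1)_w`» of the road owner LH2-plan (g1)'s RULING (10)′ (2026-09-02T15:59:16Z), seat LH7-p04 (g8); statement-first box LHref-N LH2 #9 GREEN.  Consumers:
(10)(B) «central generator» (F0P3a-p08), (11) junction (LH3-p03).  Count-neutral ASSEMBLY of ★ bricks; no new analysis; pays no organ by itself.

THE MATHEMATICS.  `G′_w = U(α)_w = U(σ_w diag α)(ℂ) ≅ U(2,1)` at a split-chart place `w ∈ S′` of a diagonal house frame; the local chart functional ★ `chartOrbGLoc L α w S′ ν_w f c`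
(`= t(B′_w) · ∫_{U(α)_w ⧸ T′_{S′,w}} f(x · γ_w(c) · x⁻¹) d(ν_w∕t)`, ★ `chartOrbGLoc_eq_of_isHaarMeasure`; `γ_w(c) = gprimeBlockAt α w S′ c` the boost with eigenvalues `boostEig c =
(e^{x+iθ}, e^{iφ}, e^{−x+iθ})`, `c = (x, φ, θ)`).  The frame `φ_w : U(α)_w ≃ₜ* U(Φ₃)(ℂ)` of ★ (A2) carries `T′_{S′,w}` onto the diagonal split Cartan `T = torusU` and `γ_w(c)` to
`τ c = diag(boostEig c)`; the transported quotient measure reads `C • ((k, n) ↦ k n T)_*(κ ⊗ μ_N)` in the Iwasawa decomposition `U(Φ₃) = K T N` (★ (e3-1)∕(A2), binder `hμC`).  By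
Harish-Chandra's parabolic descent (★ (e3-3)∕(e3-4a): the twist `n ↦ (t⁻¹ n t) n⁻¹` of the Heisenberg group `N` has module `|det(1 − Ad t⁻¹)|_𝔫|⁻¹ = (e^{−2x}Δ(c))⁻¹`,
`Δ(c) = |eˣ − e⁻ˣ|·|e^{x+iθ} − e^{iφ}|·|e^{−x+iθ} − e^{iφ}| = |D_G(τ c)|^{1∕2}` the split-place factor of ★ `archRG`):
  **`Δ(c) • chartOrbGLoc(f)(c) = (t(B′_w) · C) • ∫_{K×N} f(φ_w⁻¹(k · (m a_{x∕2} n a_{x∕2}) · k⁻¹)) d(κ ⊗ μ_N)`**,  `m = τ(0, φ, θ)`, `a_{x∕2} = τ(x∕2, 0, 0)`, `x ≠ 0`  (§1),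
with ONE place constant `C_w := t(B′_w) · C` independent of `f` and `c` (the `K × N` parametrisation over-counts by the compact fibre `K ∩ T`; that factor is inside `C`).  The right side is
`C^∞` in `c` through the real wall `x = 0` and the scalar corner `x = 0, e^{iθ} = e^{iφ}` (★ (e3-4b)), with the WALL VALUE `C_w • ∫_{K×N} f(φ_w⁻¹(k · (τ c · n) · k⁻¹))` (§2); and for an
`Ad(K)`-invariant test function the `K`-integral drops: **`Δ(c) • chartOrbGLoc(f)(c) = (C_w · κ(K)) • ∫_N f(φ_w⁻¹(m a_{x∕2} n a_{x∕2})) dμ_N`** and, at the wall, `(C_w · κ(K)) • ∫_N f(φ_w⁻¹(τ c · n)) dμ_N`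
— «a `K`-invariant bump reads its `N`-average along the coset `m·N`» [Rogawski1990, §4.9 (4.9.2) p. 55: `F_f(m a) = Δ(ma) ∫_K ∫_N f(k⁻¹ m a n k) dn dk`].
BINDER FORM (★ (A5a) pattern): the frame `(φ, hφT, hφd)`, the Iwasawa reading `hμC` of the transported quotient measure, the compact `K`, the Haar measures `κ, μ_N`, the inversion-invariant Haar
`t` on `T′_{S′,w}` and the boost family `τ (hτT hτcoe hτmul hτd)` are HYPOTHESES, each the output of ONE ★ producer (★ (A2) `exists_splitPlace_transport_smul_map`, ★ `exists_isCompact_subgroup_unitary_mul_borelU`,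
★ `exists_torusU_boostEig_family`, ★ `chartHaarGLoc`), so the consumer fixes them ONCE and reads every `f`, `c` against the same constant.
* §1 `frame_gprimeBlockAt_eq`, `boostFamily_eq_mul_half_mul_half`, **`normaliser_smul_chartOrbGLoc_eq_smul_integral_prod`** (K1),
  **`normaliser_smul_chartOrbGLoc_eq_smul_integral_unipotent_of_conj_invariant`** (K3);
* §2 `coe_frame_symm_eq`, **`exists_contDiff_normaliser_smul_chartOrbGLoc_eq_param`** (K2, parametric), `exists_contDiff_normaliser_smul_chartOrbGLoc_eq` (one test function),
  `integral_prod_frame_symm_conj_eq_smul_integral_of_conj_invariant` (the `K`-integral drops in both (K2) integrands; wall∕corner value for `Ad(K)`-invariant bumps).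
(K4): at the quasi-split frame `β₀ = ![(2:L)⁻¹, 1, -(2:L)⁻¹]` every complex place is a split-chart place (★ `Rogawski1990.mem_splitChartPlaces_quasiSplitWeights`), so the binders'
producers ★ (A2) `exists_splitPlace_transport_smul_map (hα := quasiSplitWeights_ne_zero L) (hsp := mem_splitChartPlaces_quasiSplitWeights L w)` apply at EVERY `w` — no extra head.
HONEST LABEL: HC_CM is proved only modulo the 7 printed citations (2 remaining: hLiu418 = `stmt-HodgeConjecture-24832`, h413 = `stmt-HodgeConjecture-24833`) until rung 0
closes; measure bookkeeping for the in-house road of row 2 `stub_N8`, count-neutral (+0∕+0).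

## References
* [Varadarajan1977] V. S. Varadarajan, *Harmonic Analysis on Real Reductive Groups*, LNM 576 (1977), Part I §1.12 (`'F_f` on a Cartan subgroup without singular imaginary roots).
* [Rogawski1990] J. D. Rogawski, *Automorphic Representations of Unitary Groups in Three Variables*, Ann. of Math. Stud. 123 (1990), §4.9 (4.9.1)–(4.9.2) p. 55, §4.13 p. 70, §8.2 p. 122.
* [Knapp1986] A. W. Knapp, *Representation Theory of Semisimple Groups* (1986), Ch. V §3 (the split torus of `SU(2,1)`), Ch. XI §7 (`F_f`).
* [Gelbart1975] S. Gelbart, *Automorphic Forms on Adele Groups*, Ann. of Math. Stud. 83 (1975), Thm. 9.22 (iii), Remark 9.23 (the `K T N` quotient formula).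
* [DeitmarEchterhoff2014] A. Deitmar, S. Echterhoff, *Principles of Harmonic Analysis*, 2nd ed. (2014), Thm. 1.5.3 (invariant measures on quotients).
-/

set_option autoImplicit false

noncomputable section

open MeasureTheory MeasureTheory.Measure NumberField NumberField.InfinitePlace Matrix Complex Topology
open Literature.MeasureTheory.Group
open scoped MatrixGroups Matrix ENNReal NNReal ContDiff

namespace Literature.NumberTheory.Automorphic.UnitaryGroup

/-! ## §1 (K1) The reading off the real wall -/

section Reading

variable (L : Type) [Field L] [NumberField L] [IsCMField L] (α : Fin 3 → L) (w : {w : InfinitePlace L // IsComplex w}) (S' : Finset {w : InfinitePlace L // IsComplex w})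
  {J : Matrix (Fin 3) (Fin 3) ℂ}
  -- the frame at `w` (★ (A2) `exists_splitPlace_transport_smul_map`, clauses `hφT` and (i))
  (φ : ↥(archLocal L 3 (Matrix.diagonal α) w) ≃ₜ* ↥(unitaryGroupOfForm (starRingEnd ℂ) J))
  (hφT : ∀ g : ↥(archLocal L 3 (Matrix.diagonal α) w), φ.toMulEquiv g ∈ torusU (starRingEnd ℂ) J ↔ g ∈ chartTorusGLoc L α w S')
  (hφd : ∀ cw : Fin 3 → ℝ,
    glDiagonal 3 ℂ (fun i => Units.mk0 (boostEig cw i) (boostEig_ne_zero cw i)) = ((φ (gprimeBlockAt L α w S' cw) : ↥(unitaryGroupOfForm (starRingEnd ℂ) J)) : GL (Fin 3) ℂ))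
  -- the boost torus family on `U(J₃)(ℂ)` (★ `exists_torusU_boostEig_family`)
  (τ : (Fin 3 → ℝ) → ↥(unitaryGroupOfForm (starRingEnd ℂ) J)) (hτT : ∀ c, τ c ∈ torusU (starRingEnd ℂ) J)
  (hτcoe : ∀ c, (((τ c : ↥(unitaryGroupOfForm (starRingEnd ℂ) J)) : GL (Fin 3) ℂ) : Matrix (Fin 3) (Fin 3) ℂ) = Matrix.diagonal (boostEig c))
  (hτmul : ∀ c c', τ (c + c') = τ c * τ c')
  (hτd : ∀ c, ∃ d : Fin 3 → ℂˣ, glDiagonal 3 ℂ d = ((τ c : ↥(unitaryGroupOfForm (starRingEnd ℂ) J)) : GL (Fin 3) ℂ) ∧ ∀ i, (d i : ℂ) = boostEig c i)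

/-- `c = (0, φ, θ) + (x∕2, 0, 0) + (x∕2, 0, 0)` in `ℝ³`. [folklore] -/
private theorem splitCoord_eq_add_half_add_half' (c : Fin 3 → ℝ) : c = ![0, c 1, c 2] + ![c 0 / 2, 0, 0] + ![c 0 / 2, 0, 0] := by
  funext i
  fin_cases i <;> simp

omit [NumberField L] [IsCMField L] in
include hφd hτcoe in
/-- The frame carries the local chart point to the boost torus family: `φ (gprimeBlockAt α w S′ c) = τ c` (both have matrix `diag(boostEig c)`). [cite: Rogawski1990, §3.6 p. 31] -/
theorem frame_gprimeBlockAt_eq (cw : Fin 3 → ℝ) : φ (gprimeBlockAt L α w S' cw) = τ cw := by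
  apply Subtype.ext
  apply Units.ext
  rw [← hφd cw, coe_glDiagonal, hτcoe]
  rfl

omit [NumberField L] [IsCMField L] in
include hτmul in
/-- `τ c = τ(0, φ, θ) · τ(x∕2, 0, 0) · τ(x∕2, 0, 0)` (the boost family is a homomorphism). [cite: Rogawski1990, §4.9 p. 55] -/
theorem boostFamily_eq_mul_half_mul_half (cw : Fin 3 → ℝ) : τ cw = τ ![0, cw 1, cw 2] * τ ![cw 0 / 2, 0, 0] * τ ![cw 0 / 2, 0, 0] := by
  conv_lhs => rw [splitCoord_eq_add_half_add_half' cw]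
  rw [hτmul, hτmul]

variable [MeasurableSpace ↥(archLocal L 3 (Matrix.diagonal α) w)] [BorelSpace ↥(archLocal L 3 (Matrix.diagonal α) w)]
  [LocallyCompactSpace ↥(archLocal L 3 (Matrix.diagonal α) w)] [SecondCountableTopology ↥(archLocal L 3 (Matrix.diagonal α) w)]
  (νw : Measure ↥(archLocal L 3 (Matrix.diagonal α) w)) [νw.IsHaarMeasure] [νw.IsMulRightInvariant]
  (t : Measure ↥(chartTorusGLoc L α w S')) [t.IsHaarMeasure] [t.IsInvInvariant]
  (hJ : J = (StdForm.antidiagonal 3).over ℂ)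
  [MeasurableSpace ↥(unitaryGroupOfForm (starRingEnd ℂ) J)] [BorelSpace ↥(unitaryGroupOfForm (starRingEnd ℂ) J)]
  [MeasurableSpace (↥(unitaryGroupOfForm (starRingEnd ℂ) J) ⧸ torusU (starRingEnd ℂ) J)] [BorelSpace (↥(unitaryGroupOfForm (starRingEnd ℂ) J) ⧸ torusU (starRingEnd ℂ) J)]
  -- the Iwasawa reading of the transported quotient measure (★ (A2), last clause); the local quotient carries its Borel σ-algebra (as inside ★ `chartOrbGLoc`)
  {K : Subgroup ↥(unitaryGroupOfForm (starRingEnd ℂ) J)} (κ : Measure ↥K) [SFinite κ]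
  (μN : Measure ↥(unipotentU (starRingEnd ℂ) J)) [IsHaarMeasure μN] {C : ℝ≥0}
  (hμC : letI : MeasurableSpace (↥(archLocal L 3 (Matrix.diagonal α) w) ⧸ chartTorusGLoc L α w S') := borel _
    haveI : BorelSpace (↥(archLocal L 3 (Matrix.diagonal α) w) ⧸ chartTorusGLoc L α w S') := ⟨rfl⟩
    (quotientMeasure (chartTorusGLoc L α w S') t (isClosed_chartTorusGLoc L α w S') νw).map
        (cosetCongr φ.toMulEquiv (chartTorusGLoc L α w S') (torusU (starRingEnd ℂ) J) hφT) =
      C • Measure.map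
        (fun p : ↥K × ↥(unipotentU (starRingEnd ℂ) J) =>
          (QuotientGroup.mk ((p.1 : ↥(unitaryGroupOfForm (starRingEnd ℂ) J)) * (p.2 : ↥(unitaryGroupOfForm (starRingEnd ℂ) J))) :
            ↥(unitaryGroupOfForm (starRingEnd ℂ) J) ⧸ torusU (starRingEnd ℂ) J))
        (κ.prod μN))

include hJ hφd hμC hτT hτcoe hτmul hτd in
/-- **(K1) THE PARABOLIC READING OF THE SPLIT-CHART FUNCTIONAL, ONE PLACE, OFF THE REAL WALL.**  In the binder frame of the module docstring, for every continuous test function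
`f` on `U(α)_w` and every `c = (x, φ, θ)` with `x ≠ 0`:
`(|eˣ − e⁻ˣ|·‖e^{x+iθ} − e^{iφ}‖·‖e^{−x+iθ} − e^{iφ}‖) • chartOrbGLoc L α w S′ ν_w f c = (t(B′_w) · C) • ∫_{K×N} f(φ⁻¹(k · (τ(0,φ,θ) τ(x∕2,0,0) n τ(x∕2,0,0)) · k⁻¹)) d(κ ⊗ μ_N)` —
the normaliser is ★ `archRG`'s split-place factor token for token, the right side carries no `Δ⁻¹` and ONE place constant `t(B′_w) · C` for all `f`, `c`
(★ `chartOrbGLoc_eq_of_isHaarMeasure` → ★ (A2) transport along `cosetCongr φ` → `hμC` → ★ (e3-4a)). [cite: Rogawski1990, §4.9 (4.9.1)–(4.9.2) p. 55; §8.2 p. 122]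
[cite: Varadarajan1977, I §1.12] [cite: Gelbart1975, Thm. 9.22 (iii)] [cite: DeitmarEchterhoff2014, Thm. 1.5.3] -/
theorem normaliser_smul_chartOrbGLoc_eq_smul_integral_prod (f : ↥(archLocal L 3 (Matrix.diagonal α) w) → ℂ) (hf : Continuous f)
    (cw : Fin 3 → ℝ) (hx : cw 0 ≠ 0) :
    (|Real.exp (cw 0) - Real.exp (-cw 0)| * ‖Complex.exp ((cw 0 : ℂ) + (cw 2 : ℂ) * I) - Complex.exp ((cw 1 : ℂ) * I)‖ *
        ‖Complex.exp (-(cw 0 : ℂ) + (cw 2 : ℂ) * I) - Complex.exp ((cw 1 : ℂ) * I)‖) • chartOrbGLoc L α w S' νw f cw =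
      ((t (chartBoxImgGLoc L α w S')).toReal * (C : ℝ)) • ∫ p : ↥K × ↥(unipotentU (starRingEnd ℂ) J),
        f (φ.symm ((p.1 : ↥(unitaryGroupOfForm (starRingEnd ℂ) J)) *
          (τ ![0, cw 1, cw 2] * τ ![cw 0 / 2, 0, 0] * (p.2 : ↥(unitaryGroupOfForm (starRingEnd ℂ) J)) * τ ![cw 0 / 2, 0, 0]) *
          (p.1 : ↥(unitaryGroupOfForm (starRingEnd ℂ) J))⁻¹)) ∂(κ.prod μN) := by
  letI : MeasurableSpace (↥(archLocal L 3 (Matrix.diagonal α) w) ⧸ chartTorusGLoc L α w S') := borel _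
  haveI : BorelSpace (↥(archLocal L 3 (Matrix.diagonal α) w) ⧸ chartTorusGLoc L α w S') := ⟨rfl⟩
  -- the chart functional as a quotient integral against `ν_w ∕ t`
  rw [chartOrbGLoc_eq_of_isHaarMeasure L α w S' νw t f cw]
  -- the torus data on `U(J₃)(ℂ)`
  have hγ : φ (gprimeBlockAt L α w S' cw) = τ cw := frame_gprimeBlockAt_eq L α w S' φ hφd τ hτcoe cw
  have hγT : φ (gprimeBlockAt L α w S' cw) ∈ torusU (starRingEnd ℂ) J := by rw [hγ]; exact hτT cw
  have htms := boostFamily_eq_mul_half_mul_half τ hτmul cw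
  obtain ⟨dt, hdt, hdtc⟩ := hτd cw
  obtain ⟨ds, hds, hdsc⟩ := hτd ![cw 0 / 2, 0, 0]
  -- transport of the quotient integral along `cosetCongr φ`
  have hfφ : ((f ∘ φ.symm) ∘ φ.toMulEquiv : ↥(archLocal L 3 (Matrix.diagonal α) w) → ℂ) = f := by
    funext g
    show f (φ.symm (φ g)) = f g
    rw [ContinuousMulEquiv.symm_apply_apply]
  have htr := integral_descConj_map_cosetCongr_subgroup φ.toMulEquiv φ.continuous φ.symm.continuous (chartTorusGLoc L α w S') (torusU (starRingEnd ℂ) J) hφT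
    (quotientMeasure (chartTorusGLoc L α w S') t (isClosed_chartTorusGLoc L α w S') νw) (forall_mem_chartTorusGLoc_comm L α w S' cw)
    (LineRing.forall_mem_torusU_comm (starRingEnd ℂ) J hγT) (f ∘ φ.symm)
  rw [hfφ] at htr
  -- ★ (e3-4a) on the model, with the transported measure
  have hkey := normaliser_smul_integral_descConj_boostEig_eq_smul_integral_prod hJ κ μN _ hμC (t := φ.toMulEquiv (gprimeBlockAt L α w S' cw))
    (m := τ ![0, cw 1, cw 2]) (s := τ ![cw 0 / 2, 0, 0]) hγT (hτT _) (by rw [← htms]; exact hγ) cw hx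
    (dt := dt) (by rw [hdt, ← hγ]; rfl) hdtc (ds := ds) hds hdsc (f ∘ φ.symm) (hf.comp φ.symm.continuous)
  rw [htr] at hkey
  -- assemble: `Δ • ((t B′) * I) = (t B′) * (Δ • I) = (t B′ * C) • I′`
  rw [← mul_smul_comm, hkey, Complex.real_smul, Complex.real_smul, Complex.ofReal_mul, mul_assoc]
  rfl

include hJ hφd hμC hτT hτcoe hτmul hτd in
/-- **(K3) `Ad(K)`-INVARIANT TEST FUNCTIONS READ THEIR `N`-AVERAGE ALONG `m·N`.**  If `f ∘ φ⁻¹` is invariant under conjugation by `K` then the `K`-integral of (K1) drops: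
`Δ(c) • chartOrbGLoc(f)(c) = (t(B′_w) · C · κ(K)) • ∫_N f(φ⁻¹(τ(0,φ,θ) τ(x∕2,0,0) n τ(x∕2,0,0))) dμ_N` for `x ≠ 0` (Mathlib `integral_fun_snd`) — the group-level form of «a
`K`-invariant bump `β(‖X‖²)` reads `B(Q|_{𝔥_s})` through the `K×N` formula» ((10)(A′)'s (F3)). [cite: Rogawski1990, §4.9 (4.9.2) p. 55] [cite: Varadarajan1977, I §1.12] -/
theorem normaliser_smul_chartOrbGLoc_eq_smul_integral_unipotent_of_conj_invariant [SFinite μN] (f : ↥(archLocal L 3 (Matrix.diagonal α) w) → ℂ) (hf : Continuous f)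
    (hfK : ∀ (k : ↥K) (g : ↥(unitaryGroupOfForm (starRingEnd ℂ) J)),
      f (φ.symm ((k : ↥(unitaryGroupOfForm (starRingEnd ℂ) J)) * g * (k : ↥(unitaryGroupOfForm (starRingEnd ℂ) J))⁻¹)) = f (φ.symm g))
    (cw : Fin 3 → ℝ) (hx : cw 0 ≠ 0) :
    (|Real.exp (cw 0) - Real.exp (-cw 0)| * ‖Complex.exp ((cw 0 : ℂ) + (cw 2 : ℂ) * I) - Complex.exp ((cw 1 : ℂ) * I)‖ *
        ‖Complex.exp (-(cw 0 : ℂ) + (cw 2 : ℂ) * I) - Complex.exp ((cw 1 : ℂ) * I)‖) • chartOrbGLoc L α w S' νw f cw =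
      ((t (chartBoxImgGLoc L α w S')).toReal * (C : ℝ) * κ.real Set.univ) • ∫ n : ↥(unipotentU (starRingEnd ℂ) J),
        f (φ.symm (τ ![0, cw 1, cw 2] * τ ![cw 0 / 2, 0, 0] * (n : ↥(unitaryGroupOfForm (starRingEnd ℂ) J)) * τ ![cw 0 / 2, 0, 0])) ∂μN := by
  rw [normaliser_smul_chartOrbGLoc_eq_smul_integral_prod L α w S' φ hφT hφd τ hτT hτcoe hτmul hτd νw t hJ κ μN hμC f hf cw hx]
  set g : ↥(unipotentU (starRingEnd ℂ) J) → ℂ := fun n =>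
    f (φ.symm (τ ![0, cw 1, cw 2] * τ ![cw 0 / 2, 0, 0] * (n : ↥(unitaryGroupOfForm (starRingEnd ℂ) J)) * τ ![cw 0 / 2, 0, 0])) with hg
  have hint : (fun p : ↥K × ↥(unipotentU (starRingEnd ℂ) J) =>
      f (φ.symm ((p.1 : ↥(unitaryGroupOfForm (starRingEnd ℂ) J)) *
        (τ ![0, cw 1, cw 2] * τ ![cw 0 / 2, 0, 0] * (p.2 : ↥(unitaryGroupOfForm (starRingEnd ℂ) J)) * τ ![cw 0 / 2, 0, 0]) *
        (p.1 : ↥(unitaryGroupOfForm (starRingEnd ℂ) J))⁻¹))) = fun p => g p.2 := by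
    funext p
    exact hfK p.1 _
  rw [hint, integral_fun_snd, ← smul_assoc, smul_eq_mul]

end Reading

/-! ## §2 (K2) The smooth extension through the real wall and the scalar corner, with the wall value -/

section FrameSymm

variable (L : Type) [Field L] (α : Fin 3 → L) (w : {w : InfinitePlace L // IsComplex w}) {J : Matrix (Fin 3) (Fin 3) ℂ}
  (φ : ↥(archLocal L 3 (Matrix.diagonal α) w) ≃ₜ* ↥(unitaryGroupOfForm (starRingEnd ℂ) J))
  {T : GL (Fin 3) ℂ} (hφamb : ∀ h : ↥(archLocal L 3 (Matrix.diagonal α) w), ((φ h : ↥(unitaryGroupOfForm (starRingEnd ℂ) J)) : GL (Fin 3) ℂ) = T * (h : GL (Fin 3) ℂ) * T⁻¹)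

include hφamb in
/-- Under the ambient reading `φ h = T h T⁻¹` the inverse frame reads `φ⁻¹ v = T⁻¹ v T` in matrix currency. [cite: Rogawski1990, §3.6 p. 31] -/
theorem coe_frame_symm_eq (v : ↥(unitaryGroupOfForm (starRingEnd ℂ) J)) :
    (((φ.symm v : ↥(archLocal L 3 (Matrix.diagonal α) w)) : GL (Fin 3) ℂ) : Matrix (Fin 3) (Fin 3) ℂ) =
      ((T⁻¹ : GL (Fin 3) ℂ) : Matrix (Fin 3) (Fin 3) ℂ) * ((v : GL (Fin 3) ℂ) : Matrix (Fin 3) (Fin 3) ℂ) * ((T : GL (Fin 3) ℂ) : Matrix (Fin 3) (Fin 3) ℂ) := by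
  have h := hφamb (φ.symm v)
  rw [ContinuousMulEquiv.apply_symm_apply] at h
  have h' : ((φ.symm v : ↥(archLocal L 3 (Matrix.diagonal α) w)) : GL (Fin 3) ℂ) = T⁻¹ * (v : GL (Fin 3) ℂ) * T := by
    rw [h]; group
  rw [h', Units.val_mul, Units.val_mul]

end FrameSymm

section Wall

open scoped Matrix.Norms.Operator

variable (L : Type) [Field L] [NumberField L] [IsCMField L] (α : Fin 3 → L) (w : {w : InfinitePlace L // IsComplex w}) (S' : Finset {w : InfinitePlace L // IsComplex w})
  {J : Matrix (Fin 3) (Fin 3) ℂ}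
  (φ : ↥(archLocal L 3 (Matrix.diagonal α) w) ≃ₜ* ↥(unitaryGroupOfForm (starRingEnd ℂ) J))
  (hφT : ∀ g : ↥(archLocal L 3 (Matrix.diagonal α) w), φ.toMulEquiv g ∈ torusU (starRingEnd ℂ) J ↔ g ∈ chartTorusGLoc L α w S')
  (hφd : ∀ cw : Fin 3 → ℝ,
    glDiagonal 3 ℂ (fun i => Units.mk0 (boostEig cw i) (boostEig_ne_zero cw i)) = ((φ (gprimeBlockAt L α w S' cw) : ↥(unitaryGroupOfForm (starRingEnd ℂ) J)) : GL (Fin 3) ℂ))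
  -- the frame is an ambient conjugation (★ `exists_continuousMulEquiv_archLocal_splitChart_torusU`, clause `∃ T, …`)
  {T : GL (Fin 3) ℂ} (hφamb : ∀ h : ↥(archLocal L 3 (Matrix.diagonal α) w), ((φ h : ↥(unitaryGroupOfForm (starRingEnd ℂ) J)) : GL (Fin 3) ℂ) = T * (h : GL (Fin 3) ℂ) * T⁻¹)
  (τ : (Fin 3 → ℝ) → ↥(unitaryGroupOfForm (starRingEnd ℂ) J)) (hτT : ∀ c, τ c ∈ torusU (starRingEnd ℂ) J)
  (hτcoe : ∀ c, (((τ c : ↥(unitaryGroupOfForm (starRingEnd ℂ) J)) : GL (Fin 3) ℂ) : Matrix (Fin 3) (Fin 3) ℂ) = Matrix.diagonal (boostEig c))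
  (hτmul : ∀ c c', τ (c + c') = τ c * τ c')
  (hτd : ∀ c, ∃ d : Fin 3 → ℂˣ, glDiagonal 3 ℂ d = ((τ c : ↥(unitaryGroupOfForm (starRingEnd ℂ) J)) : GL (Fin 3) ℂ) ∧ ∀ i, (d i : ℂ) = boostEig c i)
  [MeasurableSpace ↥(archLocal L 3 (Matrix.diagonal α) w)] [BorelSpace ↥(archLocal L 3 (Matrix.diagonal α) w)]
  [LocallyCompactSpace ↥(archLocal L 3 (Matrix.diagonal α) w)] [SecondCountableTopology ↥(archLocal L 3 (Matrix.diagonal α) w)]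
  (νw : Measure ↥(archLocal L 3 (Matrix.diagonal α) w)) [νw.IsHaarMeasure] [νw.IsMulRightInvariant]
  (t : Measure ↥(chartTorusGLoc L α w S')) [t.IsHaarMeasure] [t.IsInvInvariant]
  (hJ : J = (StdForm.antidiagonal 3).over ℂ)
  [MeasurableSpace ↥(unitaryGroupOfForm (starRingEnd ℂ) J)] [BorelSpace ↥(unitaryGroupOfForm (starRingEnd ℂ) J)]
  [MeasurableSpace (↥(unitaryGroupOfForm (starRingEnd ℂ) J) ⧸ torusU (starRingEnd ℂ) J)] [BorelSpace (↥(unitaryGroupOfForm (starRingEnd ℂ) J) ⧸ torusU (starRingEnd ℂ) J)]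
  {K : Subgroup ↥(unitaryGroupOfForm (starRingEnd ℂ) J)} (hK : IsCompact (K : Set ↥(unitaryGroupOfForm (starRingEnd ℂ) J))) (κ : Measure ↥K) [IsHaarMeasure κ] [SFinite κ]
  (μN : Measure ↥(unipotentU (starRingEnd ℂ) J)) [IsHaarMeasure μN] {C : ℝ≥0}
  (hμC : letI : MeasurableSpace (↥(archLocal L 3 (Matrix.diagonal α) w) ⧸ chartTorusGLoc L α w S') := borel _
    haveI : BorelSpace (↥(archLocal L 3 (Matrix.diagonal α) w) ⧸ chartTorusGLoc L α w S') := ⟨rfl⟩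
    (quotientMeasure (chartTorusGLoc L α w S') t (isClosed_chartTorusGLoc L α w S') νw).map
        (cosetCongr φ.toMulEquiv (chartTorusGLoc L α w S') (torusU (starRingEnd ℂ) J) hφT) =
      C • Measure.map
        (fun p : ↥K × ↥(unipotentU (starRingEnd ℂ) J) =>
          (QuotientGroup.mk ((p.1 : ↥(unitaryGroupOfForm (starRingEnd ℂ) J)) * (p.2 : ↥(unitaryGroupOfForm (starRingEnd ℂ) J))) :
            ↥(unitaryGroupOfForm (starRingEnd ℂ) J) ⧸ torusU (starRingEnd ℂ) J))
        (κ.prod μN))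
  {Z : Type*} [NormedAddCommGroup Z] [NormedSpace ℝ Z] [FiniteDimensional ℝ Z]

include hJ hφd hφamb hμC hτT hτcoe hτmul hτd hK in
/-- **(K2) THE SMOOTH EXTENSION THROUGH THE WALL AND THE SCALAR CORNER, WITH THE WALL VALUE — parametric in the test function.**  For test functions `f_z` on `U(α)_w` read through a smooth
ambient `fa : Z × M₃(ℂ) → ℂ` (`f_z g = fa (z, ↑↑g)`) with ONE compact support `S₀`, there is `G ∈ C^∞(Z × ℝ³)` with: (a) `Δ(c) • chartOrbGLoc(f_z)(c) = G (z, c)` for `c 0 ≠ 0` ((K1));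
(b) `G (z, c) = (t(B′_w) · C) • ∫_{K×N} f_z(φ⁻¹(k · (τ(0,φ,θ) τ(x∕2,0,0) n τ(x∕2,0,0)) · k⁻¹))` for EVERY `c`; (c) at the wall `c 0 = 0` (the real wall of the split chart, containing the scalar corner
`x = 0, e^{iθ} = e^{iφ}`): **`G (z, c) = (t(B′_w) · C) • ∫_{K×N} f_z(φ⁻¹(k · (τ c · n) · k⁻¹))`** — ★ (e3-4b) `exists_contDiff_normaliser_smul_integral_descConj_boostEig_eq_param` transported along the
frame (`φ⁻¹ v = T⁻¹ v T` keeps ambient smoothness; `φ '' S₀` is the compact support on the model). [cite: Varadarajan1977, I §1.12] [cite: Rogawski1990, §4.13 p. 70; §8.2 p. 122]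
[cite: Knapp1986, Ch. XI §7] -/
theorem exists_contDiff_normaliser_smul_chartOrbGLoc_eq_param (fU : Z → ↥(archLocal L 3 (Matrix.diagonal α) w) → ℂ) (fa : Z × Matrix (Fin 3) (Fin 3) ℂ → ℂ)
    (hfa : ContDiff ℝ ∞ fa) (hfU : ∀ z g, fU z g = fa (z, ((g : GL (Fin 3) ℂ) : Matrix (Fin 3) (Fin 3) ℂ)))
    {S₀ : Set ↥(archLocal L 3 (Matrix.diagonal α) w)} (hS₀ : IsCompact S₀) (hfS : ∀ z g, g ∉ S₀ → fU z g = 0) :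
    ∃ G : Z × (Fin 3 → ℝ) → ℂ, ContDiff ℝ ∞ G ∧
      (∀ (z : Z) (cw : Fin 3 → ℝ), cw 0 ≠ 0 →
        (|Real.exp (cw 0) - Real.exp (-cw 0)| * ‖Complex.exp ((cw 0 : ℂ) + (cw 2 : ℂ) * I) - Complex.exp ((cw 1 : ℂ) * I)‖ *
            ‖Complex.exp (-(cw 0 : ℂ) + (cw 2 : ℂ) * I) - Complex.exp ((cw 1 : ℂ) * I)‖) • chartOrbGLoc L α w S' νw (fU z) cw = G (z, cw)) ∧
      (∀ (z : Z) (cw : Fin 3 → ℝ), G (z, cw) = ((t (chartBoxImgGLoc L α w S')).toReal * (C : ℝ)) • ∫ p : ↥K × ↥(unipotentU (starRingEnd ℂ) J),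
        fU z (φ.symm ((p.1 : ↥(unitaryGroupOfForm (starRingEnd ℂ) J)) *
          (τ ![0, cw 1, cw 2] * τ ![cw 0 / 2, 0, 0] * (p.2 : ↥(unitaryGroupOfForm (starRingEnd ℂ) J)) * τ ![cw 0 / 2, 0, 0]) *
          (p.1 : ↥(unitaryGroupOfForm (starRingEnd ℂ) J))⁻¹)) ∂(κ.prod μN)) ∧
      ∀ (z : Z) (cw : Fin 3 → ℝ), cw 0 = 0 → G (z, cw) = ((t (chartBoxImgGLoc L α w S')).toReal * (C : ℝ)) • ∫ p : ↥K × ↥(unipotentU (starRingEnd ℂ) J),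
        fU z (φ.symm ((p.1 : ↥(unitaryGroupOfForm (starRingEnd ℂ) J)) * (τ cw * (p.2 : ↥(unitaryGroupOfForm (starRingEnd ℂ) J))) *
          (p.1 : ↥(unitaryGroupOfForm (starRingEnd ℂ) J))⁻¹)) ∂(κ.prod μN) := by
  letI : MeasurableSpace (↥(archLocal L 3 (Matrix.diagonal α) w) ⧸ chartTorusGLoc L α w S') := borel _
  haveI : BorelSpace (↥(archLocal L 3 (Matrix.diagonal α) w) ⧸ chartTorusGLoc L α w S') := ⟨rfl⟩
  -- the test functions transported to the model: `F z v = f_z (φ⁻¹ v) = fa (z, T⁻¹ ↑↑v T)`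
  set F : Z → ↥(unitaryGroupOfForm (starRingEnd ℂ) J) → ℂ := fun z v => fU z (φ.symm v) with hFdef
  set fa' : Z × Matrix (Fin 3) (Fin 3) ℂ → ℂ := fun q =>
    fa (q.1, ((T⁻¹ : GL (Fin 3) ℂ) : Matrix (Fin 3) (Fin 3) ℂ) * q.2 * ((T : GL (Fin 3) ℂ) : Matrix (Fin 3) (Fin 3) ℂ)) with hfa'def
  have hfa' : ContDiff ℝ ∞ fa' := by
    rw [hfa'def]
    exact hfa.comp (contDiff_fst.prodMk ((contDiff_const.mul contDiff_snd).mul contDiff_const))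
  have hFf : ∀ z v, F z v = fa' (z, ((v : GL (Fin 3) ℂ) : Matrix (Fin 3) (Fin 3) ℂ)) := fun z v => by
    simp only [hFdef, hfa'def, hfU, coe_frame_symm_eq L α w φ hφamb v]
  have hS₀' : IsCompact (φ '' S₀) := hS₀.image φ.continuous
  have hFS : ∀ z v, v ∉ φ '' S₀ → F z v = 0 := fun z v hv => by
    simp only [hFdef]
    refine hfS z _ fun hmem => hv ⟨φ.symm v, hmem, ContinuousMulEquiv.apply_symm_apply φ v⟩
  obtain ⟨G, hG, -, hGall, hGwall⟩ := exists_contDiff_normaliser_smul_integral_descConj_boostEig_eq_param hJ κ μN _ hK hμC τ hτT hτcoe hτmul hτd F fa' hfa' hFf hS₀' hFS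
  refine ⟨fun q => (t (chartBoxImgGLoc L α w S')).toReal • G q, hG.const_smul _, fun z cw hx => ?_, fun z cw => ?_, fun z cw hx => ?_⟩
  · -- (a): (K1) for `f_z` and ★'s closed form of `G`
    have hcont : Continuous (fU z) := by
      have e : fU z = fun g : ↥(archLocal L 3 (Matrix.diagonal α) w) => fa (z, ((g : GL (Fin 3) ℂ) : Matrix (Fin 3) (Fin 3) ℂ)) := funext fun g => hfU z g
      rw [e]
      exact hfa.continuous.comp (continuous_const.prodMk (Units.continuous_val.comp continuous_subtype_val))
    show _ = (t (chartBoxImgGLoc L α w S')).toReal • G (z, cw)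
    rw [normaliser_smul_chartOrbGLoc_eq_smul_integral_prod L α w S' φ hφT hφd τ hτT hτcoe hτmul hτd νw t hJ κ μN hμC (fU z) hcont cw hx, hGall z cw, ← smul_assoc,
      smul_eq_mul]
  · show (t (chartBoxImgGLoc L α w S')).toReal • G (z, cw) = _
    rw [hGall z cw, ← smul_assoc, smul_eq_mul]
  · show (t (chartBoxImgGLoc L α w S')).toReal • G (z, cw) = _
    rw [hGwall z cw hx, ← smul_assoc, smul_eq_mul]

include hJ hφd hφamb hμC hτT hτcoe hτmul hτd hK in
/-- **(K2), one test function**: for `f = fa ∘ (↑↑·)` ambient-smooth with compact support on `U(α)_w` there is `G ∈ C^∞(ℝ³)` with `Δ(c) • chartOrbGLoc(f)(c) = G c` off the wall, the closed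
form (b) everywhere and the WALL∕CORNER VALUE `G c = (t(B′_w) · C) • ∫_{K×N} f(φ⁻¹(k · (τ c · n) · k⁻¹))` at `c 0 = 0` (the parametric head at `Z := ℝ`, constant family).
[cite: Varadarajan1977, I §1.12] [cite: Rogawski1990, §4.13 p. 70; §8.2 p. 122] -/
theorem exists_contDiff_normaliser_smul_chartOrbGLoc_eq (f : ↥(archLocal L 3 (Matrix.diagonal α) w) → ℂ) (fa : Matrix (Fin 3) (Fin 3) ℂ → ℂ)
    (hfa : ContDiff ℝ ∞ fa) (hf : ∀ g, f g = fa ((g : GL (Fin 3) ℂ) : Matrix (Fin 3) (Fin 3) ℂ))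
    {S₀ : Set ↥(archLocal L 3 (Matrix.diagonal α) w)} (hS₀ : IsCompact S₀) (hfS : ∀ g, g ∉ S₀ → f g = 0) :
    ∃ G : (Fin 3 → ℝ) → ℂ, ContDiff ℝ ∞ G ∧
      (∀ cw : Fin 3 → ℝ, cw 0 ≠ 0 →
        (|Real.exp (cw 0) - Real.exp (-cw 0)| * ‖Complex.exp ((cw 0 : ℂ) + (cw 2 : ℂ) * I) - Complex.exp ((cw 1 : ℂ) * I)‖ *
            ‖Complex.exp (-(cw 0 : ℂ) + (cw 2 : ℂ) * I) - Complex.exp ((cw 1 : ℂ) * I)‖) • chartOrbGLoc L α w S' νw f cw = G cw) ∧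
      (∀ cw : Fin 3 → ℝ, G cw = ((t (chartBoxImgGLoc L α w S')).toReal * (C : ℝ)) • ∫ p : ↥K × ↥(unipotentU (starRingEnd ℂ) J),
        f (φ.symm ((p.1 : ↥(unitaryGroupOfForm (starRingEnd ℂ) J)) *
          (τ ![0, cw 1, cw 2] * τ ![cw 0 / 2, 0, 0] * (p.2 : ↥(unitaryGroupOfForm (starRingEnd ℂ) J)) * τ ![cw 0 / 2, 0, 0]) *
          (p.1 : ↥(unitaryGroupOfForm (starRingEnd ℂ) J))⁻¹)) ∂(κ.prod μN)) ∧
      ∀ cw : Fin 3 → ℝ, cw 0 = 0 → G cw = ((t (chartBoxImgGLoc L α w S')).toReal * (C : ℝ)) • ∫ p : ↥K × ↥(unipotentU (starRingEnd ℂ) J),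
        f (φ.symm ((p.1 : ↥(unitaryGroupOfForm (starRingEnd ℂ) J)) * (τ cw * (p.2 : ↥(unitaryGroupOfForm (starRingEnd ℂ) J))) *
          (p.1 : ↥(unitaryGroupOfForm (starRingEnd ℂ) J))⁻¹)) ∂(κ.prod μN) := by
  obtain ⟨G, hG, ha, hb, hc⟩ := exists_contDiff_normaliser_smul_chartOrbGLoc_eq_param L α w S' φ hφT hφd hφamb τ hτT hτcoe hτmul hτd νw t hJ hK κ μN hμC
    (Z := ℝ) (fun _ => f) (fun q => fa q.2) (hfa.comp contDiff_snd) (fun _ g => hf g) hS₀ (fun _ g hg => hfS g hg)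
  exact ⟨fun cw => G (0, cw), hG.comp (contDiff_const.prodMk contDiff_id), fun cw hx => ha 0 cw hx, fun cw => hb 0 cw, fun cw hx => hc 0 cw hx⟩

omit [NumberField L] [IsCMField L] [MeasurableSpace ↥(archLocal L 3 (Matrix.diagonal α) w)] [BorelSpace ↥(archLocal L 3 (Matrix.diagonal α) w)]
  [LocallyCompactSpace ↥(archLocal L 3 (Matrix.diagonal α) w)] [SecondCountableTopology ↥(archLocal L 3 (Matrix.diagonal α) w)]
  [MeasurableSpace (↥(unitaryGroupOfForm (starRingEnd ℂ) J) ⧸ torusU (starRingEnd ℂ) J)] [BorelSpace (↥(unitaryGroupOfForm (starRingEnd ℂ) J) ⧸ torusU (starRingEnd ℂ) J)]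
  [BorelSpace ↥(unitaryGroupOfForm (starRingEnd ℂ) J)] [IsHaarMeasure κ] [IsHaarMeasure μN] [NormedAddCommGroup Z] [NormedSpace ℝ Z] [FiniteDimensional ℝ Z] in
/-- **The `K`-integral drops for `Ad(K)`-invariant test functions** (both integrands of (K2): the symmetric one `k·(m s n s)·k⁻¹` and the wall one `k·(τ c · n)·k⁻¹`): for any `X : N → U(J₃)`,
`∫_{K×N} f(φ⁻¹(k · X(n) · k⁻¹)) d(κ ⊗ μ_N) = κ(K) • ∫_N f(φ⁻¹(X n)) dμ_N` (Mathlib `integral_fun_snd`) — so at the wall∕corner `G c = (t(B′_w) · C · κ(K)) • ∫_N f(φ⁻¹(τ c · n)) dμ_N`.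
[cite: Rogawski1990, §4.9 (4.9.2) p. 55] -/
theorem integral_prod_frame_symm_conj_eq_smul_integral_of_conj_invariant [SFinite μN] (f : ↥(archLocal L 3 (Matrix.diagonal α) w) → ℂ)
    (hfK : ∀ (k : ↥K) (g : ↥(unitaryGroupOfForm (starRingEnd ℂ) J)),
      f (φ.symm ((k : ↥(unitaryGroupOfForm (starRingEnd ℂ) J)) * g * (k : ↥(unitaryGroupOfForm (starRingEnd ℂ) J))⁻¹)) = f (φ.symm g))
    (X : ↥(unipotentU (starRingEnd ℂ) J) → ↥(unitaryGroupOfForm (starRingEnd ℂ) J)) :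
    ∫ p : ↥K × ↥(unipotentU (starRingEnd ℂ) J),
        f (φ.symm ((p.1 : ↥(unitaryGroupOfForm (starRingEnd ℂ) J)) * X p.2 * (p.1 : ↥(unitaryGroupOfForm (starRingEnd ℂ) J))⁻¹)) ∂(κ.prod μN) =
      κ.real Set.univ • ∫ n : ↥(unipotentU (starRingEnd ℂ) J), f (φ.symm (X n)) ∂μN := by
  set g : ↥(unipotentU (starRingEnd ℂ) J) → ℂ := fun n => f (φ.symm (X n)) with hg
  have hint : (fun p : ↥K × ↥(unipotentU (starRingEnd ℂ) J) =>
      f (φ.symm ((p.1 : ↥(unitaryGroupOfForm (starRingEnd ℂ) J)) * X p.2 * (p.1 : ↥(unitaryGroupOfForm (starRingEnd ℂ) J))⁻¹))) = fun p => g p.2 := by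
    funext p
    exact hfK p.1 _
  rw [hint, integral_fun_snd]

end Wall


end Literature.NumberTheory.Automorphic.UnitaryGroup

end
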